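/-
  Summits/AtomisticToContinuum/Crystallization/Theorems/OverbindingBudgetAffineFarStraighteningSnap.lean

  residual stmt-AtomisticToContinuum-31280 · slot Z · leaf R_aff′ `AffineChartStraightening'` (…FarSlotRecord §1): brick SNAP (R1) of the radial
  development (lens-4 g59 memo NODE-g59-RaffDesign §3; critic rows 978 (d), 982 (f)): SIX-POINT SNAPPING RIGIDITY, proved SYMBOLICALLY
  (no 2×2×12×12×24 certificate).  decomp-a2c lens-4 «minimal counterexample / extremal reduction», generation 59.
  0 sorry · 0 axiom · no instance · no notation · no option.
-/
import Summits.AtomisticToContinuum.Crystallization.Theorems.OverbindingBudgetAffineFarStraighteningHook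
import Summits.AtomisticToContinuum.Crystallization.Theorems.OverbindingBudgetAffineFarStraighteningFrame

/-! # SNAP — six-point snapping rigidity (R1, PROVED)

Two adjacent framed sites read each other and their four common first-shell neighbours.  An EXACT linear relabelling `M` of these six
points (`M f = −e`, the common shell of `(0,f)` in `P'` into the common shell of `(0,e)` in `P`, brick R0 supplies it) which is
`1/5`-near-conformal is a linear ISOMETRY (`snapRigidity_holds`).  Proof (memo §3 R1, made symbolic): `c ↦ c − e/2` puts a common shell on the
circle of radius `√3/2` in `e^⊥`; the inner products available there are `3/4·{1, 1/3, −1/3, −7/9, −1}` (§1, `decide`: rectangle for fcc and a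
kite for hcp) and every common shell contains an independent pair at `±1/4` (§1); `M` maps the pair `u₁, u₂` of `f` to a pair `w₁, w₂` of `e`
with the same norms, and `⟪w₁,w₂⟫ ≠ ⟪u₁,u₂⟫` forces anisotropy `≥ 2 > 3/2 ≥ κ(M)` on `u₁ ± u₂` (§3, eight `linarith` cases);
equal Grams on the basis `(f, u₁, u₂)` make `M` norm-preserving.  This is the ONLY `θ`-sensitive brick of R_aff′
(`κ ≤ ((1+θ')/(1−θ'))²`, margin 2 vs 1.17 at θ = 1/25).
* §1 `CommonShellMenuInt`, `CommonShellGoodPairInt` (+ fcc/hcp by `decide`).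
* §2 `InCommonShell`, `IsSnap`, `SnapRigidity` (the brick, as in g59/raff/RaffBricks.lean with the common shell as a predicate).
* §3 transport + `snapRigidity_pair` (two-point form) + `snapRigidity_holds : SnapRigidity`.
-/

namespace Summit.AtomisticToContinuum.Crystallization.Theorems.OverbindingBudgetAffineFarSmoothSplit

open scoped BigOperators RealInnerProductSpace
open Literature.Geometry.DiscreteGeometry (fccTwoShellPattern hcpTwoShellPattern scaledPattern intVec intVec_sub norm_intVec
  sqNormInt fccInt hcpInt fccSecondShellInt hcpSecondShellInt sqNormInt_fccInt sqNormInt_hcpInt)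
open Module (finrank)

/-! ## §1  The common-shell figures (PROVED, by `decide`) -/

/-- Menu of inner products of two common first-shell neighbours `c, c'` of `0` and a first-shell `e`: `⟪c,c'⟫ ∈ {1, 1/2, 0, −1/3, −1/2}`
(times `N`; stated with the factor `6` to stay integral). [this file] -/
def CommonShellMenuInt (S : Finset (Fin 3 → ℤ)) (N : ℤ) : Prop :=
  ∀ e ∈ S, ∀ c ∈ S, ∀ c' ∈ S, sqNormInt (c - e) = N → sqNormInt (c' - e) = N →
    6 * dotInt c c' = 6 * N ∨ 6 * dotInt c c' = 3 * N ∨ dotInt c c' = 0 ∨ 6 * dotInt c c' = -(3 * N) ∨ 6 * dotInt c c' = -(2 * N)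

/-- Every common shell contains a pair `c₁, c₂` with `⟪c₁,c₂⟫ ∈ {1/2, 0}` (an independent, non-antipodal pair). [this file] -/
def CommonShellGoodPairInt (S : Finset (Fin 3 → ℤ)) (N : ℤ) : Prop :=
  ∀ f ∈ S, ∃ c₁ ∈ S, ∃ c₂ ∈ S, sqNormInt (c₁ - f) = N ∧ sqNormInt (c₂ - f) = N ∧ (2 * dotInt c₁ c₂ = N ∨ dotInt c₁ c₂ = 0)

/-- Menu, FCC (the figure is a rectangle with angles `arccos(±1/3)`). [this file] -/
theorem commonShellMenuInt_fcc : CommonShellMenuInt fccInt 2 := by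
  unfold CommonShellMenuInt dotInt
  decide

/-- Menu, HCP (rectangle or kite; the kite adds `arccos(−7/9)`). [this file] -/
theorem commonShellMenuInt_hcp : CommonShellMenuInt hcpInt 18 := by
  unfold CommonShellMenuInt dotInt
  decide

/-- Good pair, FCC. [this file] -/
theorem commonShellGoodPairInt_fcc : CommonShellGoodPairInt fccInt 2 := by
  unfold CommonShellGoodPairInt dotInt
  decide

/-- Good pair, HCP. [this file] -/
theorem commonShellGoodPairInt_hcp : CommonShellGoodPairInt hcpInt 18 := by
  unfold CommonShellGoodPairInt dotInt
  decide

/-! ## §2  The brick (definitions) -/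

/-- `c` is a common first-shell neighbour of `0` and `e` in the pattern `P`. [g59 memo §3] -/
def InCommonShell (P : Finset (EuclideanSpace ℝ (Fin 3))) (e c : EuclideanSpace ℝ (Fin 3)) : Prop :=
  c ∈ P ∧ ‖c‖ = 1 ∧ ‖c - e‖ = 1

/-- SNAPPED PAIR DATA: an exact linear relabelling `M` of the six shared points of two adjacent framed sites — the label `f` of the first
site (seen from the second) goes to `−e`, the common shell of `(0,f)` in `P'` into the common shell of `(0,e)` in `P` translated by `−e`.
[g59 memo §3] -/
def IsSnap (P P' : Finset (EuclideanSpace ℝ (Fin 3))) (e f : EuclideanSpace ℝ (Fin 3))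
    (M : EuclideanSpace ℝ (Fin 3) →ₗ[ℝ] EuclideanSpace ℝ (Fin 3)) : Prop :=
  M f = -e ∧ ∀ c', InCommonShell P' f c' → InCommonShell P e (M c' + e)

/-- **R1 · SNAPPING RIGIDITY.**  An exact snap which is `1/5`-near-conformal is a linear isometry. [g59 memo §3 R1] -/
def SnapRigidity : Prop :=
  ∀ (P P' : Finset (EuclideanSpace ℝ (Fin 3))), (P = fccTwoShellPattern ∨ P = hcpTwoShellPattern) →
    (P' = fccTwoShellPattern ∨ P' = hcpTwoShellPattern) → ∀ e ∈ P, ‖e‖ = 1 → ∀ f ∈ P', ‖f‖ = 1 →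
      ∀ (M : EuclideanSpace ℝ (Fin 3) →ₗ[ℝ] EuclideanSpace ℝ (Fin 3)), IsSnap P P' e f M →
        (∃ (Q : EuclideanSpace ℝ (Fin 3) →ₗᵢ[ℝ] EuclideanSpace ℝ (Fin 3)) (s : ℝ), 0 < s ∧
            ∀ v, ‖M v - s • Q v‖ ≤ 1 / 5 * s * ‖v‖) →
          ∃ U : EuclideanSpace ℝ (Fin 3) →ₗᵢ[ℝ] EuclideanSpace ℝ (Fin 3), U.toLinearMap = M

/-! ## §3  Transport and the proof (PROVED) -/

/-- Inner product of two scaled integer vectors. [folklore] -/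
theorem inner_scaled_scaled (N : ℕ) (a b : Fin 3 → ℤ) :
    ⟪(Real.sqrt N)⁻¹ • intVec a, (Real.sqrt N)⁻¹ • intVec b⟫ = ((Real.sqrt N)⁻¹) ^ 2 * (dotInt a b : ℝ) := by
  rw [real_inner_smul_left, real_inner_smul_right, inner_intVec_intVec]
  ring

/-- A unit point of `scaledPattern (S ∪ S₂) N` at distance `1` from the unit point `e = s • intVec ze` comes from a first-shell integer vector
adjacent to `ze`. [this file] -/
theorem exists_int_of_inCommonShell {S S₂ : Finset (Fin 3 → ℤ)} {N : ℕ} (hN : N ≠ 0)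
    (hfirst : ∀ z ∈ S ∪ S₂, sqNormInt z = N → z ∈ S) {ze : Fin 3 → ℤ} {c : EuclideanSpace ℝ (Fin 3)}
    (hc : InCommonShell (scaledPattern (S ∪ S₂) N) ((Real.sqrt N)⁻¹ • intVec ze) c) :
    ∃ zc ∈ S, c = (Real.sqrt N)⁻¹ • intVec zc ∧ sqNormInt (zc - ze) = N := by
  obtain ⟨hcP, hc1, hce⟩ := hc
  obtain ⟨zc, hzc, rfl⟩ := Finset.mem_image.1 hcP
  refine ⟨zc, hfirst zc hzc (sqNormInt_eq_of_norm_scaled_eq_one hN hc1), rfl, ?_⟩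
  apply sqNormInt_eq_of_norm_scaled_eq_one hN
  rwa [← intVec_sub, smul_sub]

/-- The menu, transported. [this file] -/
theorem inCommonShell_menu_scaled {S S₂ : Finset (Fin 3 → ℤ)} {N : ℕ} (hN : N ≠ 0)
    (hfirst : ∀ z ∈ S ∪ S₂, sqNormInt z = N → z ∈ S) (hmenu : CommonShellMenuInt S N)
    {e c c' : EuclideanSpace ℝ (Fin 3)} (he : e ∈ scaledPattern (S ∪ S₂) N) (he1 : ‖e‖ = 1)
    (hc : InCommonShell (scaledPattern (S ∪ S₂) N) e c) (hc' : InCommonShell (scaledPattern (S ∪ S₂) N) e c') :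
    ⟪c, c'⟫ = 1 ∨ ⟪c, c'⟫ = 1 / 2 ∨ ⟪c, c'⟫ = 0 ∨ ⟪c, c'⟫ = -(1 / 3) ∨ ⟪c, c'⟫ = -(1 / 2) := by
  have hNpos : (0 : ℝ) < (N : ℝ) := by exact_mod_cast Nat.pos_of_ne_zero hN
  have hsN : ((Real.sqrt N)⁻¹) ^ 2 = (N : ℝ)⁻¹ := by rw [inv_pow, Real.sq_sqrt hNpos.le]
  obtain ⟨ze, hze, rfl⟩ := Finset.mem_image.1 he
  have hzeS : ze ∈ S := hfirst ze hze (sqNormInt_eq_of_norm_scaled_eq_one hN he1)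
  obtain ⟨zc, hzcS, rfl, hadj⟩ := exists_int_of_inCommonShell hN hfirst hc
  obtain ⟨zc', hzc'S, rfl, hadj'⟩ := exists_int_of_inCommonShell hN hfirst hc'
  rw [inner_scaled_scaled, hsN]
  have hN' : (N : ℝ) ≠ 0 := hNpos.ne'
  rcases hmenu ze hzeS zc hzcS zc' hzc'S hadj hadj' with h | h | h | h | h
  · left
    have h' : (6 : ℝ) * (dotInt zc zc' : ℝ) = 6 * (N : ℝ) := by exact_mod_cast h
    field_simp; linarith
  · right; left
    have h' : (6 : ℝ) * (dotInt zc zc' : ℝ) = 3 * (N : ℝ) := by exact_mod_cast h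
    field_simp; linarith
  · right; right; left
    have h' : (dotInt zc zc' : ℝ) = 0 := by exact_mod_cast h
    rw [h', mul_zero]
  · right; right; right; right
    have h' : (6 : ℝ) * (dotInt zc zc' : ℝ) = -(3 * (N : ℝ)) := by exact_mod_cast h
    field_simp; linarith
  · right; right; right; left
    have h' : (6 : ℝ) * (dotInt zc zc' : ℝ) = -(2 * (N : ℝ)) := by exact_mod_cast h
    field_simp; linarith

/-- The good pair, transported. [this file] -/
theorem exists_goodPair_scaled {S S₂ : Finset (Fin 3 → ℤ)} {N : ℕ} (hN : N ≠ 0) (hSnorm : ∀ z ∈ S, sqNormInt z = N)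
    (hfirst : ∀ z ∈ S ∪ S₂, sqNormInt z = N → z ∈ S) (hgood : CommonShellGoodPairInt S N)
    {f : EuclideanSpace ℝ (Fin 3)} (hf : f ∈ scaledPattern (S ∪ S₂) N) (hf1 : ‖f‖ = 1) :
    ∃ c₁ c₂, InCommonShell (scaledPattern (S ∪ S₂) N) f c₁ ∧ InCommonShell (scaledPattern (S ∪ S₂) N) f c₂ ∧
      (⟪c₁, c₂⟫ = 1 / 2 ∨ ⟪c₁, c₂⟫ = 0) := by
  have hNpos : (0 : ℝ) < (N : ℝ) := by exact_mod_cast Nat.pos_of_ne_zero hN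
  have hsN : ((Real.sqrt N)⁻¹) ^ 2 = (N : ℝ)⁻¹ := by rw [inv_pow, Real.sq_sqrt hNpos.le]
  obtain ⟨zf, hzf, rfl⟩ := Finset.mem_image.1 hf
  have hzfS : zf ∈ S := hfirst zf hzf (sqNormInt_eq_of_norm_scaled_eq_one hN hf1)
  obtain ⟨c₁, hc₁, c₂, hc₂, h₁, h₂, hdot⟩ := hgood zf hzfS
  have hmem : ∀ c ∈ S, (Real.sqrt N)⁻¹ • intVec c ∈ scaledPattern (S ∪ S₂) N := fun c hc =>
    Finset.mem_image_of_mem _ (Finset.mem_union_left _ hc)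
  have hsh : ∀ c ∈ S, sqNormInt (c - zf) = N →
      InCommonShell (scaledPattern (S ∪ S₂) N) ((Real.sqrt N)⁻¹ • intVec zf) ((Real.sqrt N)⁻¹ • intVec c) := fun c hc hcf =>
    ⟨hmem c hc, norm_scaled_eq_one hN (hSnorm c hc), by rw [← dist_eq_norm]; exact dist_scaled_eq_one hN hcf⟩
  refine ⟨_, _, hsh c₁ hc₁ h₁, hsh c₂ hc₂ h₂, ?_⟩
  rw [inner_scaled_scaled, hsN]
  have hN' : (N : ℝ) ≠ 0 := hNpos.ne'
  rcases hdot with h | h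
  · left
    have h' : (2 : ℝ) * (dotInt c₁ c₂ : ℝ) = (N : ℝ) := by exact_mod_cast h
    field_simp; linarith
  · right
    have h' : (dotInt c₁ c₂ : ℝ) = 0 := by exact_mod_cast h
    rw [h', mul_zero]

/-- The menu for the two-shell patterns. [this file] -/
theorem inCommonShell_menu {P : Finset (EuclideanSpace ℝ (Fin 3))} (hP : P = fccTwoShellPattern ∨ P = hcpTwoShellPattern)
    {e c c' : EuclideanSpace ℝ (Fin 3)} (he : e ∈ P) (he1 : ‖e‖ = 1) (hc : InCommonShell P e c) (hc' : InCommonShell P e c') :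
    ⟪c, c'⟫ = 1 ∨ ⟪c, c'⟫ = 1 / 2 ∨ ⟪c, c'⟫ = 0 ∨ ⟪c, c'⟫ = -(1 / 3) ∨ ⟪c, c'⟫ = -(1 / 2) := by
  rcases hP with rfl | rfl
  · exact inCommonShell_menu_scaled two_ne_zero (by exact_mod_cast mem_fccInt_of_sqNormInt) (by exact_mod_cast commonShellMenuInt_fcc)
      he he1 hc hc'
  · exact inCommonShell_menu_scaled (by norm_num) (by exact_mod_cast mem_hcpInt_of_sqNormInt) (by exact_mod_cast commonShellMenuInt_hcp)
      he he1 hc hc'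

/-- The good pair for the two-shell patterns. [this file] -/
theorem exists_goodPair {P : Finset (EuclideanSpace ℝ (Fin 3))} (hP : P = fccTwoShellPattern ∨ P = hcpTwoShellPattern)
    {f : EuclideanSpace ℝ (Fin 3)} (hf : f ∈ P) (hf1 : ‖f‖ = 1) :
    ∃ c₁ c₂, InCommonShell P f c₁ ∧ InCommonShell P f c₂ ∧ (⟪c₁, c₂⟫ = 1 / 2 ∨ ⟪c₁, c₂⟫ = 0) := by
  rcases hP with rfl | rfl
  · have hS : ∀ z ∈ fccInt, sqNormInt z = ((2 : ℕ) : ℤ) := sqNormInt_fccInt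
    exact exists_goodPair_scaled two_ne_zero hS (by exact_mod_cast mem_fccInt_of_sqNormInt)
      (by exact_mod_cast commonShellGoodPairInt_fcc) hf hf1
  · have hS : ∀ z ∈ hcpInt, sqNormInt z = ((18 : ℕ) : ℤ) := sqNormInt_hcpInt
    exact exists_goodPair_scaled (by norm_num) hS (by exact_mod_cast mem_hcpInt_of_sqNormInt)
      (by exact_mod_cast commonShellGoodPairInt_hcp) hf hf1

-- `inner_eq_half_of_unit` = `real_inner_eq_half` of `…StraighteningFrame` (same namespace; gate dedup) — imported and used instead.

/-- Half-frame vectors `x − g/2`: squared norm `3/4`. [folklore] -/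
theorem norm_sq_sub_half {x g : EuclideanSpace ℝ (Fin 3)} (hx : ‖x‖ = 1) (hg : ‖g‖ = 1) (hxg : ‖x - g‖ = 1) :
    ‖x - (1 / 2 : ℝ) • g‖ ^ 2 = 3 / 4 := by
  have h := real_inner_eq_half hx hg hxg
  rw [norm_sub_sq_real, real_inner_smul_right, norm_smul, Real.norm_of_nonneg (by norm_num : (0 : ℝ) ≤ 1 / 2), hx, hg, h]
  norm_num

/-- Half-frame vectors are orthogonal to the axis. [folklore] -/
theorem inner_sub_half_axis {x g : EuclideanSpace ℝ (Fin 3)} (hx : ‖x‖ = 1) (hg : ‖g‖ = 1) (hxg : ‖x - g‖ = 1) :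
    ⟪x - (1 / 2 : ℝ) • g, g⟫ = 0 := by
  have h := real_inner_eq_half hx hg hxg
  rw [inner_sub_left, real_inner_smul_left, real_inner_self_eq_norm_sq, hg, h]
  norm_num

/-- Inner product of two half-frame vectors. [folklore] -/
theorem inner_sub_half_sub_half {x x' g : EuclideanSpace ℝ (Fin 3)} (hx : ‖x‖ = 1) (hx' : ‖x'‖ = 1) (hg : ‖g‖ = 1)
    (hxg : ‖x - g‖ = 1) (hx'g : ‖x' - g‖ = 1) :
    ⟪x - (1 / 2 : ℝ) • g, x' - (1 / 2 : ℝ) • g⟫ = ⟪x, x'⟫ - 1 / 4 := by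
  have h := real_inner_eq_half hx hg hxg
  have h' := real_inner_eq_half hx' hg hx'g
  simp only [inner_sub_left, inner_sub_right, real_inner_smul_left, real_inner_smul_right]
  rw [real_inner_self_eq_norm_sq, hg, real_inner_comm x' g, h, h']
  norm_num

/-- Squared norm of a three-term combination in terms of the Gram data. [folklore] -/
theorem norm_sq_combo_norm (x y z : EuclideanSpace ℝ (Fin 3)) (a b c : ℝ) :
    ‖a • x + b • y + c • z‖ ^ 2 =
      a ^ 2 * ‖x‖ ^ 2 + b ^ 2 * ‖y‖ ^ 2 + c ^ 2 * ‖z‖ ^ 2 + 2 * a * b * ⟪x, y⟫ + 2 * a * c * ⟪x, z⟫ + 2 * b * c * ⟪y, z⟫ := by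
  rw [← real_inner_self_eq_norm_sq, ← real_inner_self_eq_norm_sq x, ← real_inner_self_eq_norm_sq y, ← real_inner_self_eq_norm_sq z]
  simp only [inner_add_left, inner_add_right, real_inner_smul_left, real_inner_smul_right]
  rw [real_inner_comm x y, real_inner_comm x z, real_inner_comm y z]
  ring

/-- **R1 · SNAPPING RIGIDITY, two-point form.**  Only `M f = −e` and the images of ONE independent pair `c₁, c₂` of the common
shell of `f` (`⟪c₁,c₂⟫ ∈ {1/2, 0}`, supplied by `exists_goodPair`) are needed; `P'` is arbitrary.  This is the form used by the
development, where the exact relabelling is DEFINED on the basis `(f, c₁, c₂)`. [this file; g59 memo §3 R1] -/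
theorem snapRigidity_pair {P P' : Finset (EuclideanSpace ℝ (Fin 3))} (hP : P = fccTwoShellPattern ∨ P = hcpTwoShellPattern)
    {e f c₁ c₂ : EuclideanSpace ℝ (Fin 3)} (he : e ∈ P) (he1 : ‖e‖ = 1) (hf1 : ‖f‖ = 1)
    (hc₁ : InCommonShell P' f c₁) (hc₂ : InCommonShell P' f c₂) (hpair : ⟪c₁, c₂⟫ = 1 / 2 ∨ ⟪c₁, c₂⟫ = 0)
    (M : EuclideanSpace ℝ (Fin 3) →ₗ[ℝ] EuclideanSpace ℝ (Fin 3)) (hMf : M f = -e)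
    (hd₁ : InCommonShell P e (M c₁ + e)) (hd₂ : InCommonShell P e (M c₂ + e))
    (hconf : ∃ (Q : EuclideanSpace ℝ (Fin 3) →ₗᵢ[ℝ] EuclideanSpace ℝ (Fin 3)) (s : ℝ), 0 < s ∧
      ∀ v, ‖M v - s • Q v‖ ≤ 1 / 5 * s * ‖v‖) :
    ∃ U : EuclideanSpace ℝ (Fin 3) →ₗᵢ[ℝ] EuclideanSpace ℝ (Fin 3), U.toLinearMap = M := by
  obtain ⟨Q, s, hs, hconf⟩ := hconf
  -- near-conformality: two-sided bounds
  have hup : ∀ v, ‖M v‖ ≤ 6 / 5 * s * ‖v‖ := by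
    intro v
    have h1 := norm_sub_norm_le (M v) (s • Q v)
    have h2 : ‖s • Q v‖ = s * ‖v‖ := by rw [norm_smul, Real.norm_of_nonneg hs.le, Q.norm_map]
    linarith [hconf v]
  have hlow : ∀ v, 4 / 5 * s * ‖v‖ ≤ ‖M v‖ := by
    intro v
    have h1 := norm_sub_norm_le (s • Q v) (M v)
    have h2 : ‖s • Q v‖ = s * ‖v‖ := by rw [norm_smul, Real.norm_of_nonneg hs.le, Q.norm_map]
    rw [norm_sub_rev] at h1
    linarith [hconf v]
  -- the menu on the image pair
  have hmenu := inCommonShell_menu hP he he1 hd₁ hd₂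
  obtain ⟨-, hc₁1, hc₁f⟩ := hc₁
  obtain ⟨-, hc₂1, hc₂f⟩ := hc₂
  obtain ⟨-, hd₁1, hd₁e⟩ := hd₁
  obtain ⟨-, hd₂1, hd₂e⟩ := hd₂
  rw [add_sub_cancel_right] at hd₁e hd₂e
  -- half-frame vectors
  obtain ⟨u₁, hu₁⟩ : ∃ u, u = c₁ - (1 / 2 : ℝ) • f := ⟨_, rfl⟩
  obtain ⟨u₂, hu₂⟩ : ∃ u, u = c₂ - (1 / 2 : ℝ) • f := ⟨_, rfl⟩
  obtain ⟨w₁, hw₁⟩ : ∃ w, w = (M c₁ + e) - (1 / 2 : ℝ) • e := ⟨_, rfl⟩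
  obtain ⟨w₂, hw₂⟩ : ∃ w, w = (M c₂ + e) - (1 / 2 : ℝ) • e := ⟨_, rfl⟩
  have hd₁e' : ‖M c₁ + e - e‖ = 1 := by rw [add_sub_cancel_right]; exact hd₁e
  have hd₂e' : ‖M c₂ + e - e‖ = 1 := by rw [add_sub_cancel_right]; exact hd₂e
  have hMu₁ : M u₁ = w₁ := by rw [hu₁, hw₁, map_sub, map_smul, hMf]; module
  have hMu₂ : M u₂ = w₂ := by rw [hu₂, hw₂, map_sub, map_smul, hMf]; module
  have hnu₁ : ‖u₁‖ ^ 2 = 3 / 4 := by rw [hu₁]; exact norm_sq_sub_half hc₁1 hf1 hc₁f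
  have hnu₂ : ‖u₂‖ ^ 2 = 3 / 4 := by rw [hu₂]; exact norm_sq_sub_half hc₂1 hf1 hc₂f
  have hnw₁ : ‖w₁‖ ^ 2 = 3 / 4 := by rw [hw₁]; exact norm_sq_sub_half hd₁1 he1 hd₁e'
  have hnw₂ : ‖w₂‖ ^ 2 = 3 / 4 := by rw [hw₂]; exact norm_sq_sub_half hd₂1 he1 hd₂e'
  have huf₁ : ⟪u₁, f⟫ = 0 := by rw [hu₁]; exact inner_sub_half_axis hc₁1 hf1 hc₁f
  have huf₂ : ⟪u₂, f⟫ = 0 := by rw [hu₂]; exact inner_sub_half_axis hc₂1 hf1 hc₂f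
  have hwe₁ : ⟪w₁, e⟫ = 0 := by rw [hw₁]; exact inner_sub_half_axis hd₁1 he1 hd₁e'
  have hwe₂ : ⟪w₂, e⟫ = 0 := by rw [hw₂]; exact inner_sub_half_axis hd₂1 he1 hd₂e'
  have hA : ⟪u₁, u₂⟫ = ⟪c₁, c₂⟫ - 1 / 4 := by rw [hu₁, hu₂]; exact inner_sub_half_sub_half hc₁1 hc₂1 hf1 hc₁f hc₂f
  have hB : ⟪w₁, w₂⟫ = ⟪M c₁ + e, M c₂ + e⟫ - 1 / 4 := by
    rw [hw₁, hw₂]; exact inner_sub_half_sub_half hd₁1 hd₂1 he1 hd₁e' hd₂e'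
  -- anisotropy test on `u₁ ± u₂`
  have hI₁ := pow_le_pow_left₀ (by positivity) (hlow (u₁ + u₂)) 2
  have hI₂ := pow_le_pow_left₀ (norm_nonneg _) (hup (u₁ + u₂)) 2
  have hI₃ := pow_le_pow_left₀ (by positivity) (hlow (u₁ - u₂)) 2
  have hI₄ := pow_le_pow_left₀ (norm_nonneg _) (hup (u₁ - u₂)) 2
  rw [map_add, hMu₁, hMu₂] at hI₁ hI₂
  rw [map_sub, hMu₁, hMu₂] at hI₃ hI₄
  rw [mul_pow, mul_pow, norm_add_sq_real, norm_add_sq_real, hnu₁, hnu₂, hnw₁, hnw₂] at hI₁ hI₂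
  rw [mul_pow, mul_pow, norm_sub_sq_real, norm_sub_sq_real, hnu₁, hnu₂, hnw₁, hnw₂] at hI₃ hI₄
  have ht : 0 < s ^ 2 := by positivity
  have hA' : ⟪u₁, u₂⟫ = 1 / 4 ∨ ⟪u₁, u₂⟫ = -(1 / 4) := by
    rcases hpair with h | h
    · left; rw [hA, h]; norm_num
    · right; rw [hA, h]; norm_num
  have hB' : ⟪w₁, w₂⟫ = 3 / 4 ∨ ⟪w₁, w₂⟫ = 1 / 4 ∨ ⟪w₁, w₂⟫ = -(1 / 4) ∨ ⟪w₁, w₂⟫ = -(7 / 12) ∨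
      ⟪w₁, w₂⟫ = -(3 / 4) := by
    rcases hmenu with h | h | h | h | h
    · left; rw [hB, h]; norm_num
    · right; left; rw [hB, h]; norm_num
    · right; right; left; rw [hB, h]; norm_num
    · right; right; right; left; rw [hB, h]; norm_num
    · right; right; right; right; rw [hB, h]; norm_num
  -- the Gram entries agree
  have hAB : ⟪w₁, w₂⟫ = ⟪u₁, u₂⟫ := by
    generalize s ^ 2 = t at ht hI₁ hI₂ hI₃ hI₄
    rcases hA' with ha | ha <;> rcases hB' with hb | hb | hb | hb | hb <;> rw [ha, hb] at hI₁ hI₂ hI₃ hI₄ ⊢ <;> linarith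
  -- `(f, u₁, u₂)` is a basis and `M` preserves its Gram matrix
  have hA2 : ⟪u₁, u₂⟫ ^ 2 = 1 / 16 := by rcases hA' with h | h <;> rw [h] <;> norm_num
  have hli : LinearIndependent ℝ ![f, u₁, u₂] := by
    rw [Fintype.linearIndependent_iff]
    intro g hg
    simp only [Fin.sum_univ_three, Matrix.cons_val_zero, Matrix.cons_val_one, Matrix.cons_val_two, Matrix.tail_cons,
      Matrix.head_cons] at hg
    have h0 := congrArg (fun x => ⟪x, f⟫) hg
    have h1 := congrArg (fun x => ⟪x, u₁⟫) hg
    have h2 := congrArg (fun x => ⟪x, u₂⟫) hg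
    simp only [inner_add_left, real_inner_smul_left, inner_zero_left, real_inner_self_eq_norm_sq, hf1, huf₁, huf₂, hnu₁, hnu₂,
      one_pow, mul_one, mul_zero, add_zero] at h0 h1 h2
    rw [real_inner_comm u₁ f, huf₁, real_inner_comm u₁ u₂] at h1
    rw [real_inner_comm u₂ f, huf₂] at h2
    simp only [mul_zero, zero_add] at h1 h2
    have hg1 : (9 / 16 - ⟪u₁, u₂⟫ ^ 2) * g 1 = 0 := by linear_combination (3 / 4 : ℝ) * h1 - ⟪u₁, u₂⟫ * h2
    have hg2 : (9 / 16 - ⟪u₁, u₂⟫ ^ 2) * g 2 = 0 := by linear_combination (3 / 4 : ℝ) * h2 - ⟪u₁, u₂⟫ * h1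
    rw [hA2] at hg1 hg2
    norm_num at hg1 hg2
    intro i
    fin_cases i
    · exact h0
    · exact hg1
    · exact hg2
  have hcard : Fintype.card (Fin 3) = finrank ℝ (EuclideanSpace ℝ (Fin 3)) := by
    rw [Fintype.card_fin, finrank_euclideanSpace_fin]
  have hnorm : ∀ v, ‖M v‖ = ‖v‖ := by
    intro v
    obtain ⟨g0, g1, g2, hv⟩ : ∃ g0 g1 g2 : ℝ, v = g0 • f + g1 • u₁ + g2 • u₂ := by
      let bE := basisOfLinearIndependentOfCardEqFinrank hli hcard
      have hbE : (bE : Fin 3 → EuclideanSpace ℝ (Fin 3)) = ![f, u₁, u₂] := coe_basisOfLinearIndependentOfCardEqFinrank hli hcard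
      refine ⟨bE.repr v 0, bE.repr v 1, bE.repr v 2, ?_⟩
      have h := bE.sum_repr v
      rw [Fin.sum_univ_three, hbE] at h
      simpa using h.symm
    subst hv
    have hsq : ‖M (g0 • f + g1 • u₁ + g2 • u₂)‖ ^ 2 = ‖g0 • f + g1 • u₁ + g2 • u₂‖ ^ 2 := by
      rw [map_add, map_add, map_smul, map_smul, map_smul, hMf, hMu₁, hMu₂, norm_sq_combo_norm, norm_sq_combo_norm, norm_neg, he1, hf1,
        inner_neg_left, inner_neg_left, real_inner_comm w₁ e, real_inner_comm w₂ e, hwe₁, hwe₂, real_inner_comm u₁ f,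
        real_inner_comm u₂ f, huf₁, huf₂, hnu₁, hnu₂, hnw₁, hnw₂, hAB, neg_zero]
    rw [← Real.sqrt_sq (norm_nonneg (M (g0 • f + g1 • u₁ + g2 • u₂))), hsq, Real.sqrt_sq (norm_nonneg _)]
  exact ⟨⟨M, hnorm⟩, rfl⟩

/-- **R1 · SNAPPING RIGIDITY holds.** [this file; g59 memo §3 R1] -/
theorem snapRigidity_holds : SnapRigidity := by
  intro P P' hP hP' e he he1 f hf hf1 M hM hconf
  obtain ⟨hMf, hMsh⟩ := hM
  obtain ⟨c₁, c₂, hc₁, hc₂, hpair⟩ := exists_goodPair hP' hf hf1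
  exact snapRigidity_pair hP he he1 hf1 hc₁ hc₂ hpair M hMf (hMsh c₁ hc₁) (hMsh c₂ hc₂) hconf

end Summit.AtomisticToContinuum.Crystallization.Theorems.OverbindingBudgetAffineFarSmoothSplit
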